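import Summits.BirchSwinnertonDyer.BirchSwinnertonDyer.Theorems.PrintCf2RubinValueTwoFourTermCFTLayerCharacters
import HarnessLib

/-!
# The four-term sequence of class field theory at a finite level, XII: plumbing of the (e)-PAIRING on `Γ_K` —
# values depend only on Artin symbols; the inertia groups above a place form a closed set; a Selmer character of
# `H′ = Gal(K̄/𝔎_∞)` extends to a deep layer `G_N = Gal(K̄/F_N)` UNRAMIFIED above a prescribed finite set of places

Cell `bsd-print-cf2` (HOME `run/shared/lean/pub/bsd-print-cf2/`), seat `bsd-line-cf2c-w6` g4, brick §4(d)
«four-term sequence `0 → Ē_∞ → U_v → 𝒳^{(v)} → A_∞ → 0` (CFT over `𝔎_∞L′`)» of LEAD memo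
`Cruxes/SplitBadTwoRankOneOfFacts/RULING-B23-g13.md` §4, crux of record stmt-BirchSwinnertonDyer-24033
`PrintCf2RubinValueTwo.TwoVariableMainConjAtSplitTwoQuad`. Sequel to files IX–XI. The (e)-pairing of the (d)-sockets
is `u(m)(s) := F(g)`, where `s` is a Selmer class over `𝔎_∞ = K̄^{H′}` read as a character `f_s : H′ → A` with open
kernel, `F : G_N → A` an extension of `f_s` to a layer `G_N = Gal(K̄/F_N) ≥ H′` (file X `exists_extension_to_layer`),
and `g ∈ G_n ≤ G_N` an Artin lift of the idèle `ι(x_n)` of a representative of `m` (files X–XI). THIS file supplies the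
three remaining generic facts that make this value well defined:

* **`apply_eq_of_absGaloisAbProj_absGalEquiv_eq`** — a character of `G_F` into a commutative group with open kernel
  takes the same value on two elements with the same Artin symbol `(E.absGalEquiv ·)|_{F^ab}` (an open kernel is closed
  and contains the commutators, hence the closed commutator subgroup defining `Γ_F^ab`);
* **`isClosed_setOf_exists_mem_inertia`** — for a finite set `T` of places of `K`, the union of the inertia groups
  `I_𝔓(Γ_K)` over all primes `𝔓` of `\bar ℤ_K` above places in `T` is CLOSED (it is the image of the compact
  `Γ_K × I_{𝔓₀}` under conjugation, prime by prime: `Γ_K` permutes the primes above `v` transitively);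
* **`exists_extension_to_layer_forall_inertia`** — a character `f` of `H′` with open kernel killing `H′ ∩ I_𝔓` for all
  `𝔓` above the places of `T` (the Selmer conditions at `T ∋ v̄`) extends, on some deep layer `G_N`, to a character `F`
  with open kernel killing `G_N ∩ I_𝔓` for all those `𝔓` — file X's `exists_extension_to_layer` and
  `exists_forall_mem_apply_eq_one` with the closed set of the previous item: «`𝔎_∞` absorbs the ramification at `v̄`».

No `sorry`, no definition, no named fact; Theses-free. No summit statement is proved; BSD is not advanced here.

## References
* [deShalit1987] Ch. III §1.1–1.3. [Rubin1991] §4 (5) p. 36. [NeukirchANT1999] Ch. I §9, Ch. IV §1 (1.2).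
* [CasselsFrohlichANT1967] J. Tate, Ch. VII §5.4–5.6 (`Γ^ab`).
-/

noncomputable section

set_option linter.dupNamespace false -- D-0017: single-problem summit, `…BirchSwinnertonDyer.BirchSwinnertonDyer…` repeats a namespace by design
set_option autoImplicit false

open Field NumberField IsDedekindDomain
open scoped Pointwise
open Literature.NumberTheory Literature.NumberTheory.NumberFields Literature.NumberTheory.GaloisRepresentations
  Literature.NumberTheory.GaloisRepresentations.IdeleClassBar

namespace Summit.BirchSwinnertonDyer.BirchSwinnertonDyer.Theorems.PrintCf2.FourTermCFT

variable {K : Type} [Field K]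

/-! ### Values depend only on Artin symbols -/

/-- **A character of `Γ_F` into a commutative group with open kernel factors through `Γ_F^ab`**: it takes equal values
on elements with the same image under `absGaloisAbProj F` (its kernel is an open, hence closed, subgroup containing all
commutators, so it contains the closed commutator subgroup). [cite: CasselsFrohlichANT1967, Ch. VII §5.4–5.6] -/
theorem apply_eq_of_absGaloisAbProj_eq {F : Type} [Field F] {A : Type*} [CommGroup A]
    (χ : absoluteGaloisGroup F →* A) (hχ : IsOpen (χ.ker : Set (absoluteGaloisGroup F)))
    {γ γ' : absoluteGaloisGroup F} (h : absGaloisAbProj F γ = absGaloisAbProj F γ') : χ γ = χ γ' := by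
  have hle : (commutator (absoluteGaloisGroup F)).topologicalClosure ≤ χ.ker := by
    refine Subgroup.topologicalClosure_minimal _ ?_ (Subgroup.isClosed_of_isOpen _ hχ)
    rw [commutator_eq_closure, Subgroup.closure_le]
    rintro g ⟨a, b, rfl⟩
    rw [SetLike.mem_coe, MonoidHom.mem_ker, map_commutatorElement, commutatorElement_eq_one_iff_commute]
    exact Commute.all _ _
  have h' : γ⁻¹ * γ' ∈ (commutator (absoluteGaloisGroup F)).topologicalClosure := by
    rw [← QuotientGroup.eq]
    exact h
  have hk := hle h'
  rw [MonoidHom.mem_ker, map_mul, map_inv, inv_mul_eq_one] at hk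
  exact hk

/-- **On `G_F ≤ Γ_K`: a character with open kernel (subspace topology) into a commutative group takes the same value on
two elements with the same Artin symbol `(E.absGalEquiv ·)|_{F^ab}`** — so the (e)-pairing value `F(g)` depends only on
`[ι(x_n), F_n]`, not on the chosen lift `g`. [cite: CasselsFrohlichANT1967, Ch. VII §5.4–5.6] -/
theorem apply_eq_of_absGaloisAbProj_absGalEquiv_eq (E : GalLayer K) {A : Type*} [CommGroup A]
    (χ : (E.openNormalSubgroup : Subgroup (absoluteGaloisGroup K)) →* A)
    (hχ : IsOpen (χ.ker : Set (E.openNormalSubgroup : Subgroup (absoluteGaloisGroup K))))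
    {u u' : (E.openNormalSubgroup : Subgroup (absoluteGaloisGroup K))}
    (h : absGaloisAbProj E.1 (E.absGalEquiv u) = absGaloisAbProj E.1 (E.absGalEquiv u')) : χ u = χ u' := by
  let χ' : absoluteGaloisGroup E.1 →* A := χ.comp E.absGalEquiv.symm.toMonoidHom
  have hχ' : IsOpen (χ'.ker : Set (absoluteGaloisGroup E.1)) := by
    have : (χ'.ker : Set (absoluteGaloisGroup E.1)) = E.absGalEquiv.symm ⁻¹' (χ.ker : Set _) := by
      ext γ
      simp only [SetLike.mem_coe, MonoidHom.mem_ker, Set.mem_preimage, χ', MonoidHom.comp_apply,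
        MulEquiv.coe_toMonoidHom]
    rw [this]
    exact hχ.preimage (continuous_absGalEquiv_symm E)
  have key := apply_eq_of_absGaloisAbProj_eq χ' hχ' h
  simpa [χ'] using key

/-! ### The inertia groups above finitely many places form a closed set -/

/-- **The union of the inertia groups `I_𝔓(Γ_K)` over the primes `𝔓` of `\bar ℤ_K` above the places of a finite set `T`
is closed**: above one place it is the image of the compact `Γ_K × I_{𝔓₀}` under `(σ, g) ↦ σgσ⁻¹` (`Γ_K` acts
transitively on the primes above `v`, `exists_smul_eq_of_mem_primesAbove_holds`; `I_{σ𝔓₀} = σ I_{𝔓₀} σ⁻¹`,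
`inertia_smul_eq_map_conj`; `I_{𝔓₀}` is closed, `absIntegers.isClosed_inertia_holds`).
[cite: NeukirchANT1999, Ch. I §9 Prop. (9.1), (9.4); Ch. IV §1 (1.2)] -/
theorem isClosed_setOf_exists_mem_inertia [NumberField K] (T : Finset (HeightOneSpectrum (𝓞 K))) :
    IsClosed {g : absoluteGaloisGroup K | ∃ v ∈ T, ∃ 𝔓 ∈ v.primesAbove, g ∈ 𝔓.inertia (absoluteGaloisGroup K)} := by
  have hset : {g : absoluteGaloisGroup K | ∃ v ∈ T, ∃ 𝔓 ∈ v.primesAbove, g ∈ 𝔓.inertia (absoluteGaloisGroup K)} =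
      ⋃ v ∈ T, {g : absoluteGaloisGroup K | ∃ 𝔓 ∈ v.primesAbove, g ∈ 𝔓.inertia (absoluteGaloisGroup K)} := by
    ext g
    simp only [Set.mem_setOf_eq, Set.mem_iUnion, exists_prop]
  rw [hset]
  refine T.finite_toSet.isClosed_biUnion fun v _ => ?_
  -- above one place: the image of `Γ_K × I_{𝔓₀}` under conjugation
  obtain ⟨𝔓₀, h𝔓₀⟩ : ∃ 𝔓₀ : Ideal (absIntegers (𝓞 K) K), 𝔓₀ ∈ v.primesAbove :=
    ⟨adicCompletionPrime K v, adicCompletionPrime_mem_primesAbove K v⟩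
  have hI : IsClosed (𝔓₀.inertia (absoluteGaloisGroup K) : Set (absoluteGaloisGroup K)) :=
    absIntegers.isClosed_inertia_holds 𝔓₀
  have hcpt : IsCompact ((Set.univ : Set (absoluteGaloisGroup K)) ×ˢ
      (𝔓₀.inertia (absoluteGaloisGroup K) : Set (absoluteGaloisGroup K))) :=
    isCompact_univ.prod hI.isCompact
  have hcont : Continuous fun q : absoluteGaloisGroup K × absoluteGaloisGroup K => q.1 * q.2 * q.1⁻¹ := by
    fun_prop
  have heq : {g : absoluteGaloisGroup K | ∃ 𝔓 ∈ v.primesAbove, g ∈ 𝔓.inertia (absoluteGaloisGroup K)} =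
      (fun q : absoluteGaloisGroup K × absoluteGaloisGroup K => q.1 * q.2 * q.1⁻¹) ''
        ((Set.univ : Set (absoluteGaloisGroup K)) ×ˢ (𝔓₀.inertia (absoluteGaloisGroup K) : Set (absoluteGaloisGroup K))) := by
    ext g
    simp only [Set.mem_setOf_eq, Set.mem_image, Set.mem_prod, Set.mem_univ, true_and, SetLike.mem_coe,
      Prod.exists]
    constructor
    · rintro ⟨𝔓, h𝔓, hg⟩
      obtain ⟨σ, rfl⟩ := HeightOneSpectrum.exists_smul_eq_of_mem_primesAbove_holds h𝔓₀ h𝔓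
      rw [inertia_smul_eq_map_conj, Subgroup.mem_map] at hg
      obtain ⟨g₀, hg₀, rfl⟩ := hg
      exact ⟨σ, g₀, hg₀, rfl⟩
    · rintro ⟨σ, g₀, hg₀, rfl⟩
      refine ⟨σ • 𝔓₀, smul_mem_primesAbove h𝔓₀ σ, ?_⟩
      rw [inertia_smul_eq_map_conj, Subgroup.mem_map]
      exact ⟨g₀, hg₀, rfl⟩
  rw [heq]
  exact (hcpt.image hcont).isClosed

/-! ### Extending a Selmer character of `H′` to a deep layer, unramified above `T` -/

/-- **A character of `H′` with open kernel, killing `H′ ∩ I_𝔓` for every prime `𝔓` of `\bar ℤ_K` above the places of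
a finite set `T`, extends on some deep layer `G_N ≥ H′` to a character `F` with open kernel killing `G_N ∩ I_𝔓` for all
those `𝔓`.** (`G_n` antitone closed with `H′ ≤ G_n`, `⨅ G_n ≤ H′`: the layers `Gal(K̄/F_n)` of a tower exhausting
`𝔎_∞`.) In the (e)-pairing: `f = f_s` a Selmer class over `𝔎_∞` (unramified at the places of `T = {v̄}` resp.
`T = {v̄} ∪ {w ∣ 𝔣}`), and the conclusion is that the finite-level character `F` through which `u(m)(s)` is read is
unramified above `T` — although `𝔎_∞/F_N` ramifies at `v̄`. [cite: deShalit1987, Ch. III §1.1–1.3]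
[cite: NeukirchANT1999, Ch. IV §1 (1.2)] -/
theorem exists_extension_to_layer_forall_inertia [NumberField K] {A : Type*} [CommGroup A]
    {H : Subgroup (absoluteGaloisGroup K)} {G : ℕ → Subgroup (absoluteGaloisGroup K)}
    (hG : Antitone G) (hcl : ∀ n, IsClosed (G n : Set (absoluteGaloisGroup K))) (hHG : ∀ n, H ≤ G n)
    (hGH : ⨅ n, G n ≤ H) (T : Finset (HeightOneSpectrum (𝓞 K)))
    (f : H →* A) (hf : IsOpen (f.ker : Set H))
    (hfT : ∀ v ∈ T, ∀ 𝔓 ∈ v.primesAbove, ∀ h : H, (h : absoluteGaloisGroup K) ∈ 𝔓.inertia (absoluteGaloisGroup K) →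
      f h = 1) :
    ∃ (N : ℕ) (F : G N →* A), (∀ h : H, F (Subgroup.inclusion (hHG N) h) = f h) ∧
      IsOpen (F.ker : Set (G N)) ∧
      ∀ v ∈ T, ∀ 𝔓 ∈ v.primesAbove, ∀ g : G N,
        (g : absoluteGaloisGroup K) ∈ 𝔓.inertia (absoluteGaloisGroup K) → F g = 1 := by
  obtain ⟨N₀, F₀, O, hF₀H, hF₀O⟩ := exists_extension_to_layer hG hcl hHG hGH f hf
  -- `ker F₀` is open: it contains the trace of the open `O`
  have hF₀ : IsOpen (F₀.ker : Set (G N₀)) := by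
    apply Subgroup.isOpen_mono (H₁ := (O : Subgroup (absoluteGaloisGroup K)).subgroupOf (G N₀))
    · intro g hg
      exact hF₀O g (Subgroup.mem_subgroupOf.1 hg)
    · exact O.isOpen.preimage continuous_subtype_val
  -- deep layers kill the closed set of inertia elements above `T`
  obtain ⟨N, hN, hFN⟩ := exists_forall_mem_apply_eq_one hG hcl hHG hGH (isClosed_setOf_exists_mem_inertia T)
    F₀ hF₀ (fun h hh => by
      obtain ⟨v, hv, 𝔓, h𝔓, hh𝔓⟩ := hh
      rw [hF₀H]
      exact hfT v hv 𝔓 h𝔓 h hh𝔓)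
  refine ⟨N, F₀.comp (Subgroup.inclusion (hG hN)), fun h => hF₀H h, ?_, fun v hv 𝔓 h𝔓 g hg =>
    hFN g ⟨v, hv, 𝔓, h𝔓, hg⟩⟩
  rw [← MonoidHom.comap_ker]
  exact hF₀.preimage (continuous_inclusion (hG hN))


/-! ### Appendix (g4, later the same session): two extensions agree on the deep layers -/

/-- **Two extensions of the same character of `H′` agree on the deep layers.** If `F₁, F₂ : G_{N₀} → A` have open
kernels and agree on `H` (`H ≤ G_n` antitone closed, `⨅ G_n ≤ H`, in a compact group), then `F₁ = F₂` on `G_N` for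
`N ≫ N₀` — `exists_forall_mem_apply_eq_one` for `F₁/F₂` and the closed set `C = Γ`. In the (e)-pairing: the value
`u(m)(s) = F_s(u)` does not depend on the chosen extension `F_s` of the Selmer character `f_s`, once the Artin lift `u`
is taken in a deep enough layer. [cite: deShalit1987, Ch. III §1.1–1.3] [cite: NeukirchANT1999, Ch. IV §1 (1.2)] -/
theorem exists_forall_apply_eq_of_forall_apply_inclusion_eq {Γ : Type*} [Group Γ] [TopologicalSpace Γ]
    [IsTopologicalGroup Γ] [CompactSpace Γ] {A : Type*} [CommGroup A]
    {H : Subgroup Γ} {G : ℕ → Subgroup Γ}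
    (hG : Antitone G) (hcl : ∀ n, IsClosed (G n : Set Γ)) (hHG : ∀ n, H ≤ G n) (hGH : ⨅ n, G n ≤ H)
    {N₀ : ℕ} (F₁ F₂ : G N₀ →* A) (hF₁ : IsOpen (F₁.ker : Set (G N₀))) (hF₂ : IsOpen (F₂.ker : Set (G N₀)))
    (hH : ∀ h : H, F₁ (Subgroup.inclusion (hHG N₀) h) = F₂ (Subgroup.inclusion (hHG N₀) h)) :
    ∃ N, ∃ hN : N₀ ≤ N, ∀ g : G N, F₁ (Subgroup.inclusion (hG hN) g) = F₂ (Subgroup.inclusion (hG hN) g) := by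
  -- the quotient character `F₁/F₂` has open kernel (it contains `ker F₁ ∩ ker F₂`) and kills `H`
  let D : G N₀ →* A := F₁ * F₂⁻¹
  have hD : IsOpen (D.ker : Set (G N₀)) := by
    apply Subgroup.isOpen_mono (H₁ := F₁.ker ⊓ F₂.ker)
    · intro g hg
      rw [MonoidHom.mem_ker]
      change F₁ g * (F₂ g)⁻¹ = 1
      rw [(MonoidHom.mem_ker).1 hg.1, (MonoidHom.mem_ker).1 hg.2, inv_one, mul_one]
    · exact hF₁.inter hF₂
  obtain ⟨N, hN, hDN⟩ := exists_forall_mem_apply_eq_one hG hcl hHG hGH isClosed_univ D hD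
    (fun h _ => by
      change F₁ (Subgroup.inclusion (hHG N₀) h) * (F₂ (Subgroup.inclusion (hHG N₀) h))⁻¹ = 1
      rw [hH h, mul_inv_cancel])
  refine ⟨N, hN, fun g => ?_⟩
  have h1 : F₁ (Subgroup.inclusion (hG hN) g) * (F₂ (Subgroup.inclusion (hG hN) g))⁻¹ = 1 :=
    hDN g (Set.mem_univ _)
  rwa [mul_inv_eq_one] at h1

end Summit.BirchSwinnertonDyer.BirchSwinnertonDyer.Theorems.PrintCf2.FourTermCFT

end
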